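import Summits.QuantumAdvantage.QuantumAdvantage.Theorems.NearExactIsExact.Negative.CornerFlatRankFourCubic
import Summits.QuantumAdvantage.QuantumAdvantage.Theorems.NearExactIsExact.Negative.CornerFlatRankFourSixteen

/-!
# Corner-flat pairs of rank 4, IV-b: the frame-free isotropy ceiling (hyperplane sections of the fibres)

Negative-side (disprover lane, unit `b2b-cforr-disprove-g33`, 2026-08-23) sequel of
`Negative/CornerFlatRankFourCeiling.lean` / `…Cubic.lean` / `…Sixteen.lean` for the crux
`CubicForrelation.NearExactIsExact`.  The framed ceiling `cfr_forrelation_le_fifteen_sixteenths_of_cubic` needed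
an AFFINE frame vector `u₂` spanning, with `u₃,u₄`, a `B`-isotropic hyperplane of the fibre.  Here the frame
disappears: the mismatch witness is the parity of `h` on a HYPERPLANE SECTION
`{q : λ_J(corner(x,q)) = c}`, `λ_J(y) = ⊕_{j∈J} y_j`, of the sixteen-corner fibre (`J = {j₀}`: coordinate halves).

* `cff_total_even` — a cubic `h` has even weight on every fibre (fourth derivative of a cubic).
* `cff_section_deg` — **the section parity is quadratic in `x`**: expanding the quartic `[λ_J(y) = c]·h(y)` in
  monomials, the sixteen-corner sum of `y_S` is `0` for `|S| ≤ 3` and the Pfaffian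
  `B_ij B_kl ⊕ B_ik B_jl ⊕ B_il B_jk` of the Plücker 2-vector for `|S| = 4` (`cfs_flat_sum_le3/4`), and `B(x)`
  is affine for cubic `f` (`cfr_pluecker_affine_of_cubic`).
* `cff_forrelation_le_fifteen_sixteenths` (`_of_cubic`) — **frame-free rank-4 ceiling**: `f` a cubic rank-4
  corner flat, `h` cubic; if ONE fibre has ONE section `{λ_J = c}` of odd `h`-parity then `Φ(f,g) ≤ 15/16`
  (both sides of the section are then odd by `cff_total_even`, the fibre carries two mismatches by
  `cff_fibre_sum_le_twelve_of_sections`, and the quadratic witness has weight `≥ 2^{a-2}` by `stub_rmWeight`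
  inside `cfr_forrelation_le_of_bad_fibres`).
* `cff_window_sections_even_of_cubic`, `cff_window_halves_even_of_cubic` — contrapositive: in a window pair
  (`Φ > 15/16`) of this habitat EVERY section `{λ_J = c}` of EVERY fibre is `h`-even.  Since the corner map is
  injective, the `λ_J` induce every affine functional of the fibre, so `h` meets every affine hyperplane of every
  fibre evenly: `h ∘ corner(x, ·) ∈ RM(1,4)^⊥ = RM(2,4)` is QUADRATIC in `q`, i.e. the cubic part of `h` is
  totally isotropic on every fibre — the isotropy lemma with no frame hypothesis left (this last reading is
  informal; the theorems below state the section parities).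

Standard three axioms only.
-/

set_option linter.dupNamespace false -- D-0017: single-problem summit ⇒ `QuantumAdvantage.QuantumAdvantage` by design

noncomputable section

namespace Summit.QuantumAdvantage.QuantumAdvantage.Theorems.NearExactIsExact.Negative.CornerFlatRankFour

open Finset
open Literature.Computability.QuantumComplexity
open Literature.Computability.QuantumComplexity.BuzetChailloux (bxor)
open Literature.Computability.QuantumComplexity.QuadPolar (two_eq_zero)
open Summit.QuantumAdvantage.QuantumAdvantage.Theorems.CubicForrelation.NearExactIsExact
open Summit.QuantumAdvantage.QuantumAdvantage.Theorems.NearExactIsExact.Negative.SkewProductCore (ind ind_and ind_xor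
  ind_true ind_false decide_ind_eq_one ind_decide_eq_one isDegLeFun_sum)
open Summit.QuantumAdvantage.QuantumAdvantage.Theorems.NearExactIsExact.Negative.CornerFlatPluecker (cfp_eval_ind)

variable {a m : ℕ}

section HalfParity

/-! ### The half-fibre parity of a cubic is quadratic -/

/-- A monomial of a polynomial of total degree `≤ D` involves at most `D` variables. [folklore] -/
theorem cff_card_support_le {D : ℕ} {p : MvPolynomial (Fin m) (ZMod 2)} (hp : p.totalDegree ≤ D)
    {d : Fin m →₀ ℕ} (hd : d ∈ p.support) : d.support.card ≤ D := by
  have h1 : (d.sum fun _ e => e) ≤ D := (MvPolynomial.le_totalDegree hd).trans hp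
  have h2 : d.support.card ≤ d.sum fun _ e => e := by
    show d.support.card ≤ ∑ i ∈ d.support, d i
    rw [card_eq_sum_ones]
    exact sum_le_sum fun i hi => Nat.one_le_iff_ne_zero.mpr (Finsupp.mem_support_iff.mp hi)
  exact h2.trans h1

/-- The sixteen-corner sum `x ↦ Σ_q Π_{t∈S} [corner(x,q)_t]` of a monomial `y_S`, `|S| ≤ 4`, over a rank-4 corner
flat has degree `≤ 2` in `x` once the Pfaffians of the Plücker 2-vector do: it is `0` for `|S| ≤ 3` and the
Pfaffian for `|S| = 4` (`cfs_flat_sum_le3`, `cfs_flat_sum4`). [folklore] -/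
theorem cff_monomial_deg (S : Finset (Fin m)) (hS : S.card ≤ 4)
    {w u₁ u₂ u₃ u₄ : (Fin a → Bool) → (Fin m → Bool)}
    (hPf : ∀ i j k l : Fin m, IsDegLeFun 2 (fun x =>
      (((((u₁ x i && u₂ x j) ^^ (u₁ x j && u₂ x i)) ^^ ((u₃ x i && u₄ x j) ^^ (u₃ x j && u₄ x i))) &&
          (((u₁ x k && u₂ x l) ^^ (u₁ x l && u₂ x k)) ^^ ((u₃ x k && u₄ x l) ^^ (u₃ x l && u₄ x k)))) ^^
        ((((u₁ x i && u₂ x k) ^^ (u₁ x k && u₂ x i)) ^^ ((u₃ x i && u₄ x k) ^^ (u₃ x k && u₄ x i))) &&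
          (((u₁ x j && u₂ x l) ^^ (u₁ x l && u₂ x j)) ^^ ((u₃ x j && u₄ x l) ^^ (u₃ x l && u₄ x j)))) ^^
        ((((u₁ x i && u₂ x l) ^^ (u₁ x l && u₂ x i)) ^^ ((u₃ x i && u₄ x l) ^^ (u₃ x l && u₄ x i))) &&
          (((u₁ x j && u₂ x k) ^^ (u₁ x k && u₂ x j)) ^^ ((u₃ x j && u₄ x k) ^^ (u₃ x k && u₄ x j))))))) :
    IsDegLeFun 2 (fun x => decide ((∑ q : (Bool × Bool) × (Bool × Bool), ∏ t ∈ S,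
      ind (w x t ^^ (q.1.1 && u₁ x t) ^^ (q.1.2 && u₂ x t) ^^ (q.2.1 && u₃ x t) ^^ (q.2.2 && u₄ x t))) = 1)) := by
  by_cases h3 : S.card ≤ 3
  · refine rm_isDegLeFun_congr (isDegLeFun_const 2 false) fun x => ?_
    rw [cfs_flat_sum_le3 (w x) (u₁ x) (u₂ x) (u₃ x) (u₄ x) S h3]
    decide
  · obtain ⟨i, hi⟩ : S.Nonempty := card_pos.mp (by omega)
    have hE3 : (S.erase i).card = 3 := by
      rw [card_erase_of_mem hi]
      omega
    obtain ⟨j, k, l, hjk, hjl, hkl, hE⟩ := Finset.card_eq_three.mp hE3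
    have hiE : i ∉ ({j, k, l} : Finset (Fin m)) := hE ▸ Finset.notMem_erase i S
    have hSeq : S = insert i {j, k, l} := by rw [← hE, insert_erase hi]
    have hj : j ∉ ({k, l} : Finset (Fin m)) := by simp [hjk, hjl]
    have hk : k ∉ ({l} : Finset (Fin m)) := by simpa using hkl
    refine rm_isDegLeFun_congr (hPf i j k l) fun x => ?_
    rw [hSeq, cfs_flat_sum4 (w x) (u₁ x) (u₂ x) (u₃ x) (u₄ x) hiE hj hk, decide_ind_eq_one]

/-- **A cubic has even weight on every rank-4 fibre** (`Σ_q [h(corner q)] = 0`: a fourth derivative of a cubic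
vanishes; no frame or injectivity hypothesis). [folklore] -/
theorem cff_total_even {h : (Fin m → Bool) → Bool} (hh : IsDegLeFun 3 h) (w u₁ u₂ u₃ u₄ : Fin m → Bool)
    (cx : (Bool × Bool) × (Bool × Bool) → (Fin m → Bool))
    (hc : ∀ q t, cx q t = (w t ^^ (q.1.1 && u₁ t) ^^ (q.1.2 && u₂ t) ^^ (q.2.1 && u₃ t) ^^ (q.2.2 && u₄ t))) :
    (∑ q, ind (h (cx q))) = 0 := by
  classical
  obtain ⟨p, hp3, hrep⟩ := hh
  have hev : ∀ y, ind (h y) = ∑ d ∈ p.support, p.coeff d * ∏ i ∈ d.support, ind (y i) := by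
    intro y
    rw [hrep y, polyPhase_apply, ind_decide_eq_one, cfp_eval_ind]
  calc (∑ q, ind (h (cx q)))
      = ∑ q, ∑ d ∈ p.support, p.coeff d * ∏ i ∈ d.support, ind (cx q i) := sum_congr rfl fun q _ => hev _
    _ = ∑ d ∈ p.support, p.coeff d * ∑ q, ∏ i ∈ d.support, ind (cx q i) := by
        rw [sum_comm]
        simp only [← mul_sum]
    _ = 0 := sum_eq_zero fun d hd => by
        simp only [hc]
        rw [cfs_flat_sum_le3 w u₁ u₂ u₃ u₄ d.support (cff_card_support_le hp3 hd), mul_zero]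

/-- The half indicator as an `𝔽₂`-factor: `[b = c]·E = ([b] + 1 + [c])·E`. [folklore] -/
theorem cff_filter_factor : ∀ (b c : Bool) (E : ZMod 2), (if b = c then E else 0) = (ind b + (1 + ind c)) * E := by
  decide

/-- The section functional `λ_J` is affine along the fibre:
`[λ_J(corner q) = 1] = [λ_J(w) = 1] ⊕ q₁₁[λ_J(u₁) = 1] ⊕ ⋯ ⊕ q₂₂[λ_J(u₄) = 1]`. [folklore] -/
theorem cff_section_affine (J : Finset (Fin m)) (w u₁ u₂ u₃ u₄ : Fin m → Bool)
    (q : (Bool × Bool) × (Bool × Bool)) :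
    decide ((∑ j ∈ J, ind (w j ^^ (q.1.1 && u₁ j) ^^ (q.1.2 && u₂ j) ^^ (q.2.1 && u₃ j) ^^ (q.2.2 && u₄ j))) = 1) =
      (decide ((∑ j ∈ J, ind (w j)) = 1) ^^ (q.1.1 && decide ((∑ j ∈ J, ind (u₁ j)) = 1)) ^^
        (q.1.2 && decide ((∑ j ∈ J, ind (u₂ j)) = 1)) ^^ (q.2.1 && decide ((∑ j ∈ J, ind (u₃ j)) = 1)) ^^
        (q.2.2 && decide ((∑ j ∈ J, ind (u₄ j)) = 1))) := by
  simp only [ind_xor, ind_and, sum_add_distrib, ← mul_sum, zmod2_decide_add, zmod2_decide_mul, decide_ind_eq_one]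

/-- **The section parity of a cubic is quadratic.**  For cubic `h` and a rank-4 corner flat whose Plücker
Pfaffians are quadratic in `x` (e.g. `B(x)` coordinatewise affine), the parity of `h` on the section
`{q : λ_J(corner(x,q)) = c}` of the fibre at `x` has degree `≤ 2` in `x`: it is the sixteen-corner sum of the
quartic `[λ_J(y) = c]·h(y)`, i.e. a sum of Pfaffians `Pf_S(B(x))`, `|S| = 4` (`cff_monomial_deg`). [folklore] -/
theorem cff_section_deg {h : (Fin m → Bool) → Bool} (hh : IsDegLeFun 3 h)
    {w u₁ u₂ u₃ u₄ : (Fin a → Bool) → (Fin m → Bool)}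
    (corner : (Fin a → Bool) → (Bool × Bool) × (Bool × Bool) → (Fin m → Bool))
    (hc : ∀ x q t, corner x q t =
      (w x t ^^ (q.1.1 && u₁ x t) ^^ (q.1.2 && u₂ x t) ^^ (q.2.1 && u₃ x t) ^^ (q.2.2 && u₄ x t)))
    (hPf : ∀ i j k l : Fin m, IsDegLeFun 2 (fun x =>
      (((((u₁ x i && u₂ x j) ^^ (u₁ x j && u₂ x i)) ^^ ((u₃ x i && u₄ x j) ^^ (u₃ x j && u₄ x i))) &&
          (((u₁ x k && u₂ x l) ^^ (u₁ x l && u₂ x k)) ^^ ((u₃ x k && u₄ x l) ^^ (u₃ x l && u₄ x k)))) ^^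
        ((((u₁ x i && u₂ x k) ^^ (u₁ x k && u₂ x i)) ^^ ((u₃ x i && u₄ x k) ^^ (u₃ x k && u₄ x i))) &&
          (((u₁ x j && u₂ x l) ^^ (u₁ x l && u₂ x j)) ^^ ((u₃ x j && u₄ x l) ^^ (u₃ x l && u₄ x j)))) ^^
        ((((u₁ x i && u₂ x l) ^^ (u₁ x l && u₂ x i)) ^^ ((u₃ x i && u₄ x l) ^^ (u₃ x l && u₄ x i))) &&
          (((u₁ x j && u₂ x k) ^^ (u₁ x k && u₂ x j)) ^^ ((u₃ x j && u₄ x k) ^^ (u₃ x k && u₄ x j)))))))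
    (J : Finset (Fin m)) (c : Bool) :
    IsDegLeFun 2 (fun x => decide
      ((∑ q ∈ univ.filter (fun q => decide ((∑ j ∈ J, ind (corner x q j)) = 1) = c),
        ind (h (corner x q))) = 1)) := by
  classical
  obtain ⟨p, hp3, hrep⟩ := hh
  set P : MvPolynomial (Fin m) (ZMod 2) :=
    (∑ j ∈ J, MvPolynomial.X j + MvPolynomial.C (1 + ind c)) * p with hPdef
  have hP4 : P.totalDegree ≤ 4 := by
    refine (MvPolynomial.totalDegree_mul _ _).trans ?_
    have hX : (∑ j ∈ J, MvPolynomial.X j : MvPolynomial (Fin m) (ZMod 2)).totalDegree ≤ 1 :=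
      MvPolynomial.totalDegree_finsetSum_le fun j _ => by rw [MvPolynomial.totalDegree_X]
    have hlin : (∑ j ∈ J, MvPolynomial.X j + MvPolynomial.C (1 + ind c) :
        MvPolynomial (Fin m) (ZMod 2)).totalDegree ≤ 1 :=
      (MvPolynomial.totalDegree_add _ _).trans (max_le hX (by rw [MvPolynomial.totalDegree_C]; exact zero_le_one))
    omega
  have hPev : ∀ y : Fin m → Bool, ((∑ j ∈ J, ind (y j)) + (1 + ind c)) * ind (h y) =
      ∑ d ∈ P.support, P.coeff d * ∏ i ∈ d.support, ind (y i) := by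
    intro y
    rw [← cfp_eval_ind, hPdef, map_mul, map_add, map_sum, MvPolynomial.eval_C, hrep y, polyPhase_apply,
      ind_decide_eq_one]
    simp only [MvPolynomial.eval_X]
    rfl
  have e : ∀ x, (∑ q ∈ univ.filter (fun q => decide ((∑ j ∈ J, ind (corner x q j)) = 1) = c),
      ind (h (corner x q))) =
      ∑ d ∈ P.support, P.coeff d * ∑ q : (Bool × Bool) × (Bool × Bool), ∏ t ∈ d.support,
        ind (w x t ^^ (q.1.1 && u₁ x t) ^^ (q.1.2 && u₂ x t) ^^ (q.2.1 && u₃ x t) ^^ (q.2.2 && u₄ x t)) := by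
    intro x
    rw [sum_filter]
    calc (∑ q, if decide ((∑ j ∈ J, ind (corner x q j)) = 1) = c then ind (h (corner x q)) else 0)
        = ∑ q : (Bool × Bool) × (Bool × Bool), ∑ d ∈ P.support, P.coeff d * ∏ t ∈ d.support,
            ind (corner x q t) :=
          sum_congr rfl fun q _ => by rw [cff_filter_factor, ind_decide_eq_one, hPev]
      _ = ∑ d ∈ P.support, P.coeff d * ∑ q : (Bool × Bool) × (Bool × Bool), ∏ t ∈ d.support,
            ind (corner x q t) := by
          rw [sum_comm]
          simp only [← mul_sum]
      _ = _ := by simp only [hc]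
  refine rm_isDegLeFun_congr ?_ fun x => by rw [e x]
  refine isDegLeFun_sum (fun d x => P.coeff d * ∑ q : (Bool × Bool) × (Bool × Bool), ∏ t ∈ d.support,
    ind (w x t ^^ (q.1.1 && u₁ x t) ^^ (q.1.2 && u₂ x t) ^^ (q.2.1 && u₃ x t) ^^ (q.2.2 && u₄ x t)))
    P.support fun d hd => ?_
  exact rm_isDegLeFun_congr
    (acq_deg_band (isDegLeFun_const 0 (decide (P.coeff d = 1)))
      (cff_monomial_deg d.support (cff_card_support_le hP4 hd) hPf) (by norm_num))
    fun x => (zmod2_decide_mul _ _).symm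

end HalfParity

section Ceiling

/-! ### The frame-free ceiling -/

/-- The dual quadratic `e ⊕ q₁₁q₁₂ ⊕ q₂₁q₂₂` has even weight on each affine section
`{q : ω ⊕ q₁₁β₁ ⊕ q₁₂β₂ ⊕ q₂₁β₃ ⊕ q₂₂β₄ = c}` of the corner cube (`2⁷` cases, `decide`; restated from
`cfr_half_dual_even`). [folklore] -/
theorem cff_section_dual_even (ω β₁ β₂ β₃ β₄ c e : Bool) :
    (∑ q ∈ (univ : Finset ((Bool × Bool) × (Bool × Bool))).filter
        (fun q => (ω ^^ (q.1.1 && β₁) ^^ (q.1.2 && β₂) ^^ (q.2.1 && β₃) ^^ (q.2.2 && β₄)) = c),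
      (ind e + ind (q.1.1 && q.1.2) + ind (q.2.1 && q.2.2))) = 0 :=
  cfr_half_dual_even ω β₁ β₂ β₃ β₄ c e

/-- **Two mismatches from odd section parities** (`cfr_fibre_sum_le_twelve_of_halves` with the coordinate
`(cx q)_l` replaced by any predicate `π` affine in `q`): odd `h`-parity on both sides `{π = c}` of the fibre
forces a mismatch against the dual quadratic on each side, hence a signed corner sum `≤ 12`. [folklore] -/
theorem cff_fibre_sum_le_twelve_of_sections (h : (Fin m → Bool) → Bool)
    (cx : (Bool × Bool) × (Bool × Bool) → (Fin m → Bool)) (e : Bool) (π : (Bool × Bool) × (Bool × Bool) → Bool)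
    (ω β₁ β₂ β₃ β₄ : Bool)
    (hπ : ∀ q, π q = (ω ^^ (q.1.1 && β₁) ^^ (q.1.2 && β₂) ^^ (q.2.1 && β₃) ^^ (q.2.2 && β₄)))
    (hodd : ∀ c : Bool, (∑ q ∈ univ.filter (fun q => π q = c), ind (h (cx q))) = 1) :
    ∑ q, signOf (h (cx q) ^^ e ^^ (q.1.1 && q.1.2) ^^ (q.2.1 && q.2.2)) ≤ 12 := by
  classical
  have hex : ∀ c : Bool, ∃ q : (Bool × Bool) × (Bool × Bool), π q = c ∧
      (h (cx q) ^^ e ^^ (q.1.1 && q.1.2) ^^ (q.2.1 && q.2.2)) = true := by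
    intro c
    by_contra hno
    push Not at hno
    have hzero : (∑ q ∈ univ.filter (fun q => π q = c),
        ind (h (cx q) ^^ e ^^ (q.1.1 && q.1.2) ^^ (q.2.1 && q.2.2))) = 0 :=
      sum_eq_zero fun q hq => by
        rw [Bool.eq_false_iff.mpr (hno q (mem_filter.mp hq).2), ind_false]
    have heven := cff_section_dual_even ω β₁ β₂ β₃ β₄ c e
    have hfl : (univ.filter fun q : (Bool × Bool) × (Bool × Bool) =>
        (ω ^^ (q.1.1 && β₁) ^^ (q.1.2 && β₂) ^^ (q.2.1 && β₃) ^^ (q.2.2 && β₄)) = c) =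
        univ.filter fun q => π q = c :=
      filter_congr fun q _ => by rw [hπ]
    rw [hfl] at heven
    simp only [ind_xor, sum_add_distrib] at hzero heven
    rw [hodd c] at hzero
    have h10 : (1 : ZMod 2) = 0 := by linear_combination hzero - heven
    exact absurd h10 (by decide)
  obtain ⟨q₀, hq₀, k₀⟩ := hex false
  obtain ⟨q₁, hq₁, k₁⟩ := hex true
  have hne : q₀ ≠ q₁ := by
    rintro rfl
    rw [hq₀] at hq₁
    exact Bool.false_ne_true hq₁
  have key := cfr_sum_signOf_le
    (fun q : (Bool × Bool) × (Bool × Bool) => h (cx q) ^^ e ^^ (q.1.1 && q.1.2) ^^ (q.2.1 && q.2.2))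
    q₀ q₁ hne k₀ k₁
  have h16 : (Fintype.card ((Bool × Bool) × (Bool × Bool)) : ℝ) - 4 ≤ 12 := by
    norm_num [Fintype.card_prod, Fintype.card_bool]
  exact key.trans h16

/-- **Frame-free rank-4 isotropy ceiling.**  In the rank-4 corner-flat habitat (`f(x₁‖x₂) =
l_{u₁}l_{u₂} ⊕ l_{u₃}l_{u₄} ⊕ l_w ⊕ f₀`, `g` bent along `φ` with dual `h`), assume `h` cubic and the Plücker
2-vector `B = u₁∧u₂ ⊕ u₃∧u₄` coordinatewise affine in `x₁` (automatic for cubic `f`,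
`cfr_pluecker_affine_of_cubic`).  If ONE fibre `x₀` has ONE section `{q : λ_J(corner(x₀,q)) = c}`,
`λ_J(y) = ⊕_{j ∈ J} y_j`, on which `h` has odd parity, then `Φ(f,g) ≤ 15/16`.  No frame vector, isotropy or
affinity of the `u_i` is assumed. [folklore] -/
theorem cff_forrelation_le_fifteen_sixteenths (l : (Fin (a + 4) → Bool) → (Fin (a + 4) → Bool) → Bool) (hl : ∀ y x, signOf (l y x) = twist x y)
    (u₁ u₂ u₃ u₄ w : (Fin a → Bool) → (Fin (a + 4) → Bool)) (f₀ : (Fin a → Bool) → Bool)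
    (φ : (Fin (a + 4) → Bool) → (Fin a → Bool)) (h : (Fin (a + 4) → Bool) → Bool)
    (f g : (Fin (a + (a + 4)) → Bool) → Bool)
    (hf : ∀ x₁ x₂, f (Fin.append x₁ x₂) =
      ((l (u₁ x₁) x₂ && l (u₂ x₁) x₂) ^^ (l (u₃ x₁) x₂ && l (u₄ x₁) x₂) ^^ l (w x₁) x₂ ^^ f₀ x₁))
    (hg : ∀ (y₁ : Fin a → Bool) (y₂ : Fin (a + 4) → Bool),
      signOf (g (Fin.append y₁ y₂)) = twist y₁ (φ y₂) * signOf (h y₂))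
    (corner : (Fin a → Bool) → (Bool × Bool) × (Bool × Bool) → (Fin (a + 4) → Bool))
    (hc : ∀ x₁ q j, corner x₁ q j =
      (w x₁ j ^^ (q.1.1 && u₁ x₁ j) ^^ (q.1.2 && u₂ x₁ j) ^^ (q.2.1 && u₃ x₁ j) ^^ (q.2.2 && u₄ x₁ j)))
    (hφ : ∀ x₁ q, φ (corner x₁ q) = x₁) (hinj : ∀ x₁, Function.Injective (corner x₁))
    (hh : IsDegLeFun 3 h)
    (hB : ∀ i j, IsDegLeFun 1 (fun x =>
      ((u₁ x i && u₂ x j) ^^ (u₁ x j && u₂ x i)) ^^ ((u₃ x i && u₄ x j) ^^ (u₃ x j && u₄ x i))))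
    (J : Finset (Fin (a + 4))) (c : Bool)
    (hone : ∃ x₀ : Fin a → Bool,
      (∑ q ∈ univ.filter (fun q => decide ((∑ j ∈ J, ind (corner x₀ q j)) = 1) = c),
        ind (h (corner x₀ q))) = 1) :
    forrelation f g ≤ 15 / 16 := by
  have hPf : ∀ i j k l' : Fin (a + 4), IsDegLeFun 2 (fun x =>
      (((((u₁ x i && u₂ x j) ^^ (u₁ x j && u₂ x i)) ^^ ((u₃ x i && u₄ x j) ^^ (u₃ x j && u₄ x i))) &&
          (((u₁ x k && u₂ x l') ^^ (u₁ x l' && u₂ x k)) ^^ ((u₃ x k && u₄ x l') ^^ (u₃ x l' && u₄ x k)))) ^^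
        ((((u₁ x i && u₂ x k) ^^ (u₁ x k && u₂ x i)) ^^ ((u₃ x i && u₄ x k) ^^ (u₃ x k && u₄ x i))) &&
          (((u₁ x j && u₂ x l') ^^ (u₁ x l' && u₂ x j)) ^^ ((u₃ x j && u₄ x l') ^^ (u₃ x l' && u₄ x j)))) ^^
        ((((u₁ x i && u₂ x l') ^^ (u₁ x l' && u₂ x i)) ^^ ((u₃ x i && u₄ x l') ^^ (u₃ x l' && u₄ x i))) &&
          (((u₁ x j && u₂ x k) ^^ (u₁ x k && u₂ x j)) ^^ ((u₃ x j && u₄ x k) ^^ (u₃ x k && u₄ x j)))))) :=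
    fun i j k l' => fc_deg_bxor (fc_deg_bxor (acq_deg_band (hB i j) (hB k l') (by norm_num))
      (acq_deg_band (hB i k) (hB j l') (by norm_num))) (acq_deg_band (hB i l') (hB j k) (by norm_num))
  refine cfr_forrelation_le_of_bad_fibres l hl u₁ u₂ u₃ u₄ w f₀ φ h f g hf hg corner hc hφ hinj
    (fun x => decide ((∑ q ∈ univ.filter (fun q => decide ((∑ j ∈ J, ind (corner x q j)) = 1) = c),
      ind (h (corner x q))) = 1))
    (cff_section_deg hh corner hc hPf J c) (fun x hx => ?_) ?_
  · have hodd : (∑ q ∈ univ.filter (fun q => decide ((∑ j ∈ J, ind (corner x q j)) = 1) = c),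
        ind (h (corner x q))) = 1 := of_decide_eq_true hx
    have htot : (∑ q, ind (h (corner x q))) = 0 :=
      cff_total_even hh (w x) (u₁ x) (u₂ x) (u₃ x) (u₄ x) (corner x) (hc x)
    refine cff_fibre_sum_le_twelve_of_sections h (corner x) (f₀ x)
      (fun q => decide ((∑ j ∈ J, ind (corner x q j)) = 1))
      (decide ((∑ j ∈ J, ind (w x j)) = 1)) (decide ((∑ j ∈ J, ind (u₁ x j)) = 1))
      (decide ((∑ j ∈ J, ind (u₂ x j)) = 1)) (decide ((∑ j ∈ J, ind (u₃ x j)) = 1))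
      (decide ((∑ j ∈ J, ind (u₄ x j)) = 1))
      (fun q => by simpa only [hc] using cff_section_affine J (w x) (u₁ x) (u₂ x) (u₃ x) (u₄ x) q)
      fun c' => ?_
    by_cases hcc : c' = c
    · rw [hcc]
      exact hodd
    · have hne : c' = !c := by cases c <;> cases c' <;> simp_all
      have hsplit := sum_filter_add_sum_filter_not univ
        (fun q => decide ((∑ j ∈ J, ind (corner x q j)) = 1) = c) fun q => ind (h (corner x q))
      rw [htot, hodd] at hsplit
      have hfilt : (univ.filter fun q => decide ((∑ j ∈ J, ind (corner x q j)) = 1) = c') =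
          univ.filter fun q => ¬decide ((∑ j ∈ J, ind (corner x q j)) = 1) = c := by
        refine filter_congr fun q _ => ?_
        rw [hne]
        cases decide ((∑ j ∈ J, ind (corner x q j)) = 1) <;> cases c <;> decide
      rw [hfilt]
      linear_combination hsplit - two_eq_zero
  · obtain ⟨x₀, hx₀⟩ := hone
    exact ⟨x₀, decide_eq_true hx₀⟩

/-- **Frame-free ceiling, cubic form**: `f` a cubic rank-4 corner flat, `h` cubic, one fibre with one section
`{λ_J = c}` of odd `h`-parity ⇒ `Φ(f,g) ≤ 15/16`. [folklore] -/
theorem cff_forrelation_le_fifteen_sixteenths_of_cubic (l : (Fin (a + 4) → Bool) → (Fin (a + 4) → Bool) → Bool) (hl : ∀ y x, signOf (l y x) = twist x y)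
    (u₁ u₂ u₃ u₄ w : (Fin a → Bool) → (Fin (a + 4) → Bool)) (f₀ : (Fin a → Bool) → Bool)
    (φ : (Fin (a + 4) → Bool) → (Fin a → Bool)) (h : (Fin (a + 4) → Bool) → Bool)
    (f g : (Fin (a + (a + 4)) → Bool) → Bool)
    (hf : ∀ x₁ x₂, f (Fin.append x₁ x₂) =
      ((l (u₁ x₁) x₂ && l (u₂ x₁) x₂) ^^ (l (u₃ x₁) x₂ && l (u₄ x₁) x₂) ^^ l (w x₁) x₂ ^^ f₀ x₁))
    (hg : ∀ (y₁ : Fin a → Bool) (y₂ : Fin (a + 4) → Bool),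
      signOf (g (Fin.append y₁ y₂)) = twist y₁ (φ y₂) * signOf (h y₂))
    (corner : (Fin a → Bool) → (Bool × Bool) × (Bool × Bool) → (Fin (a + 4) → Bool))
    (hc : ∀ x₁ q j, corner x₁ q j =
      (w x₁ j ^^ (q.1.1 && u₁ x₁ j) ^^ (q.1.2 && u₂ x₁ j) ^^ (q.2.1 && u₃ x₁ j) ^^ (q.2.2 && u₄ x₁ j)))
    (hφ : ∀ x₁ q, φ (corner x₁ q) = x₁) (hinj : ∀ x₁, Function.Injective (corner x₁))
    (hfc : IsDegLeFun 3 f) (hh : IsDegLeFun 3 h) (J : Finset (Fin (a + 4))) (c : Bool)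
    (hone : ∃ x₀ : Fin a → Bool,
      (∑ q ∈ univ.filter (fun q => decide ((∑ j ∈ J, ind (corner x₀ q j)) = 1) = c),
        ind (h (corner x₀ q))) = 1) :
    forrelation f g ≤ 15 / 16 :=
  cff_forrelation_le_fifteen_sixteenths l hl u₁ u₂ u₃ u₄ w f₀ φ h f g hf hg corner hc hφ hinj hh
    (cfr_pluecker_affine_of_cubic l hl u₁ u₂ u₃ u₄ w f₀ f hf hfc) J c hone

/-- **Window pairs have `h`-even sections everywhere.**  In the cubic rank-4 corner-flat habitat a pair with
`Φ(f,g) > 15/16` has, for EVERY fibre `x₁`, EVERY `J ⊆ Fin (a+4)` and both values `c`, an even number of ones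
of `h` on the section `{q : λ_J(corner(x₁,q)) = c}`.  As the corner map is injective the `λ_J` induce all
affine functionals of the fibre, so `h ∘ corner(x₁, ·)` meets every affine hyperplane of `𝔽₂⁴` evenly and is
therefore quadratic (`RM(1,4)^⊥ = RM(2,4)`): the cubic part of `h` is totally isotropic on every fibre.
[folklore] -/
theorem cff_window_sections_even_of_cubic (l : (Fin (a + 4) → Bool) → (Fin (a + 4) → Bool) → Bool) (hl : ∀ y x, signOf (l y x) = twist x y)
    (u₁ u₂ u₃ u₄ w : (Fin a → Bool) → (Fin (a + 4) → Bool)) (f₀ : (Fin a → Bool) → Bool)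
    (φ : (Fin (a + 4) → Bool) → (Fin a → Bool)) (h : (Fin (a + 4) → Bool) → Bool)
    (f g : (Fin (a + (a + 4)) → Bool) → Bool)
    (hf : ∀ x₁ x₂, f (Fin.append x₁ x₂) =
      ((l (u₁ x₁) x₂ && l (u₂ x₁) x₂) ^^ (l (u₃ x₁) x₂ && l (u₄ x₁) x₂) ^^ l (w x₁) x₂ ^^ f₀ x₁))
    (hg : ∀ (y₁ : Fin a → Bool) (y₂ : Fin (a + 4) → Bool),
      signOf (g (Fin.append y₁ y₂)) = twist y₁ (φ y₂) * signOf (h y₂))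
    (corner : (Fin a → Bool) → (Bool × Bool) × (Bool × Bool) → (Fin (a + 4) → Bool))
    (hc : ∀ x₁ q j, corner x₁ q j =
      (w x₁ j ^^ (q.1.1 && u₁ x₁ j) ^^ (q.1.2 && u₂ x₁ j) ^^ (q.2.1 && u₃ x₁ j) ^^ (q.2.2 && u₄ x₁ j)))
    (hφ : ∀ x₁ q, φ (corner x₁ q) = x₁) (hinj : ∀ x₁, Function.Injective (corner x₁))
    (hfc : IsDegLeFun 3 f) (hh : IsDegLeFun 3 h) (hwin : 15 / 16 < forrelation f g)
    (x₁ : Fin a → Bool) (J : Finset (Fin (a + 4))) (c : Bool) :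
    (∑ q ∈ univ.filter (fun q => decide ((∑ j ∈ J, ind (corner x₁ q j)) = 1) = c),
      ind (h (corner x₁ q))) = 0 := by
  by_contra hne
  have h01 : ∀ v : ZMod 2, ¬v = 0 → v = 1 := by decide
  exact absurd hwin (not_lt.mpr (cff_forrelation_le_fifteen_sixteenths_of_cubic l hl u₁ u₂ u₃ u₄ w f₀ φ h f g hf hg corner hc hφ hinj hfc hh J c
    ⟨x₁, h01 _ hne⟩))

/-- **Window pairs have `h`-even coordinate halves** (`J = {j₀}`): `Φ > 15/16` ⇒ `h` has an even number of
ones on each half `{q : corner(x₁,q)_{j₀} = c}` of each fibre. [folklore] -/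
theorem cff_window_halves_even_of_cubic (l : (Fin (a + 4) → Bool) → (Fin (a + 4) → Bool) → Bool) (hl : ∀ y x, signOf (l y x) = twist x y)
    (u₁ u₂ u₃ u₄ w : (Fin a → Bool) → (Fin (a + 4) → Bool)) (f₀ : (Fin a → Bool) → Bool)
    (φ : (Fin (a + 4) → Bool) → (Fin a → Bool)) (h : (Fin (a + 4) → Bool) → Bool)
    (f g : (Fin (a + (a + 4)) → Bool) → Bool)
    (hf : ∀ x₁ x₂, f (Fin.append x₁ x₂) =
      ((l (u₁ x₁) x₂ && l (u₂ x₁) x₂) ^^ (l (u₃ x₁) x₂ && l (u₄ x₁) x₂) ^^ l (w x₁) x₂ ^^ f₀ x₁))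
    (hg : ∀ (y₁ : Fin a → Bool) (y₂ : Fin (a + 4) → Bool),
      signOf (g (Fin.append y₁ y₂)) = twist y₁ (φ y₂) * signOf (h y₂))
    (corner : (Fin a → Bool) → (Bool × Bool) × (Bool × Bool) → (Fin (a + 4) → Bool))
    (hc : ∀ x₁ q j, corner x₁ q j =
      (w x₁ j ^^ (q.1.1 && u₁ x₁ j) ^^ (q.1.2 && u₂ x₁ j) ^^ (q.2.1 && u₃ x₁ j) ^^ (q.2.2 && u₄ x₁ j)))
    (hφ : ∀ x₁ q, φ (corner x₁ q) = x₁) (hinj : ∀ x₁, Function.Injective (corner x₁))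
    (hfc : IsDegLeFun 3 f) (hh : IsDegLeFun 3 h) (hwin : 15 / 16 < forrelation f g)
    (x₁ : Fin a → Bool) (j₀ : Fin (a + 4)) (c : Bool) :
    (∑ q ∈ univ.filter (fun q => corner x₁ q j₀ = c), ind (h (corner x₁ q))) = 0 := by
  have key := cff_window_sections_even_of_cubic l hl u₁ u₂ u₃ u₄ w f₀ φ h f g hf hg corner hc hφ hinj hfc hh hwin x₁ {j₀} c
  have hfilt : (univ.filter fun q => decide ((∑ j ∈ ({j₀} : Finset (Fin (a + 4))), ind (corner x₁ q j)) = 1) = c)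
      = univ.filter fun q => corner x₁ q j₀ = c :=
    filter_congr fun q _ => by rw [sum_singleton, decide_ind_eq_one]
  rwa [hfilt] at key

end Ceiling

end Summit.QuantumAdvantage.QuantumAdvantage.Theorems.NearExactIsExact.Negative.CornerFlatRankFour

end
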